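import Summits.CriticalPhenomena.PercolationContinuityZ3.Theorems.PercNearOneGluingNoHeavyQuantDIBStar
import Summits.CriticalPhenomena.PercolationContinuityZ3.Theorems.PercNearOneGluingNoHeavyQuantIndepBlobDiscountLow
import Summits.CriticalPhenomena.PercolationContinuityZ3.Theorems.PercNearOneGluingNoHeavyQuantIndepBlobOddSizeRow
import HarnessLib

/-!
# QUANT lane R8, FAR on general trees — bridges to the typed DIB row: the real-weight SMALL-BALL form with a heavy
# set (lead g15's shape) implies `DIBWith`; **DIB\* holds at every floor `≤ 1/2`** (lead g15's `dibStar_of_le_half`);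
# the term certificate α′ (heavy total `≥ 2(j − s) + 1` plus ONE blob of arbitrary gate, floor `≥ 1/2`)

builds on p205010 (kernel theorem, internal audit signed; external expert review pending)

Support file (`--supports stmt-CriticalPhenomena-4575`), QUANT lane typer seat prim-quant-stmt (gen 17), rung R8 of
`run/shared/lean/prim/quant/LADDER.md`; answers the gen-15 lead's asks (lane INBOX 06:02Z "type DIB\* with THIS data shape —
floor parameter, heavy set `H`, light gates `≤ p₀`, credited mean as the displayed sum, light non-giant, conclusion
`Σ_{W : a(W) ≤ j} w ≤ 1 − p₀` — so that `dibStar_of_le_half` discharges the `p₀ ≤ 1/2` half verbatim and the Hall–Harris half can land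
against the same statement"; 06:15Z "α′: floor `≥ 1/2` and heavy total `≥ 2j′+1` ⟹ `sizeRow_with_extra_blob`, light part free").
Theorems only, no sorries, standard axioms.

The typed row `Quant.IndepBlob.DIBWith x ψ` (`…QuantDIBStar`, p251720) has natural sizes, the heavy/light split by the predicate
`x ≤ g k`, and the TAIL form `x ≤ P(N ≥ j+1)`.  The lead's kernel rows use real weights, a heavy SET `H` (`x ≤ p` on `H`, `p ≤ x` off
`H`), a real layer, and the SMALL-BALL form `P(N ≤ j) ≤ 1 − x`.  The two shapes are interchangeable:

* `Quant.IndepBlob.DIBWith.of_smallBall_heavySet` — **a prover of (any half of) DIB\* may land the real-weight, heavy-set,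
  small-ball statement; it implies the typed row** (instantiate `H := {k : x ≤ g k}`, cast the sizes, take complements).
* `Quant.IndepBlob.DIBStar.of_le_half` — **`DIBStar x` for every `x ≤ 1/2`**, from `IndepBlob.dibStar_of_le_half`
  (`…QuantIndepBlobDiscountLow`, lead g15: Cantelli with the true mean, the discount paying exactly the variance of a light blob)
  — supersedes `dibStar_of_le_third`.  OPEN range of Conjecture DIB\*: `1/2 < x < 1` (and there only the terms 'heavy total `≤ 2j′`,
  light blob present', by α′ below).
* `Quant.RootDec.term_ge_of_credit_of_le_half` — hence at floors `x ≤ 1/2` the γ-certificate of `rtail_ge_of_decCert` is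
  UNCONDITIONAL: effective discounted credit `> 2(j − s)` ⟹ `x ≤ TERM`.
* `Quant.RootDec.term_ge_of_extraBlob` — **α′**: floor `1/2 ≤ x ≤ 1`, every blob but one (`x₀`, ANY gate) heavy, and the heavy
  sizes total `≥ 2(j − s) + 1` ⟹ `x ≤ TERM[s, a, g, j]` (`IndepBlob.sizeRow_with_extra_blob`, `…QuantIndepBlobOddSizeRow`, lead g15);
  no credit is used.  (Empty components `lo = hi` may always be given gate `1`: `TP[lo, lo, g]` does not depend on `g`.)
* `Quant.RootDec.rtail_ge_of_decCert_of_le_half` — R3 with the DIB hypothesis DISCHARGED at floors `≤ 1/2`.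

[this work]; the gluing rows served [cite: KozmaNitzan2024, Conjecture 3 (p. 15)].
-/

namespace Summit.CriticalPhenomena.PercolationContinuityZ3.Theorems

namespace Quant

namespace IndepBlob

open Finset

/-- **Small-ball form with a heavy set ⟹ the typed row.**  If for every finite blob type, real weights `a ≥ 0`, gates in `[0,1]`,
heavy set `H` (`x ≤ p` on `H`, `p ≤ x` off `H`), real layer `j` with the light blobs non-giant (`a ≤ j` off `H`) and credited mean
`Σ_H a p + Σ_{Hᶜ} a·ψ(p) > 2j` one has `P(a(W) ≤ j) ≤ 1 − x`, then `DIBWith x ψ`. [this work] -/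
theorem DIBWith.of_smallBall_heavySet {x : ℝ} {ψ : ℝ → ℝ}
    (h : ∀ (ι : Type) [Fintype ι] [DecidableEq ι] (p a : ι → ℝ) (H : Finset ι) (j : ℝ),
      (∀ i, 0 ≤ p i) → (∀ i, p i ≤ 1) → (∀ i, 0 ≤ a i) → (∀ i ∈ H, x ≤ p i) → (∀ i, i ∉ H → p i ≤ x) →
      (∀ i, i ∉ H → a i ≤ j) → 2 * j < (∑ i ∈ H, a i * p i) + ∑ i ∈ Hᶜ, a i * ψ (p i) →
      ∑ W ∈ (Finset.univ : Finset (Finset ι)).filter (fun W => ∑ i ∈ W, a i ≤ j),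
        (∏ k, if k ∈ W then p k else 1 - p k) ≤ 1 - x) :
    DIBWith x ψ := by
  intro ι _ _ a g j hg hlight hcredit
  set H : Finset ι := Finset.univ.filter (fun k => x ≤ g k) with hH
  have hmemH : ∀ k, k ∈ H ↔ x ≤ g k := fun k => by simp [hH]
  -- the credited mean in heavy-set form
  have hsplit : ∑ k, (a k : ℝ) * (if x ≤ g k then g k else ψ (g k)) =
      (∑ k ∈ H, (a k : ℝ) * g k) + ∑ k ∈ Hᶜ, (a k : ℝ) * ψ (g k) := by
    rw [← Finset.sum_add_sum_compl H]
    congr 1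
    · exact Finset.sum_congr rfl fun k hk => by rw [if_pos ((hmemH k).1 hk)]
    · exact Finset.sum_congr rfl fun k hk => by rw [if_neg (fun h' => (Finset.mem_compl.1 hk) ((hmemH k).2 h'))]
  have row := h ι g (fun k => (a k : ℝ)) H (j : ℝ) (fun k => (hg k).1) (fun k => (hg k).2) (fun k => Nat.cast_nonneg (a k))
    (fun k hk => (hmemH k).1 hk) (fun k hk => (not_le.1 fun h' => hk ((hmemH k).2 h')).le)
    (fun k hk => Nat.cast_le.2 (hlight k (not_le.1 fun h' => hk ((hmemH k).2 h')))) (by rw [← hsplit]; exact hcredit)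
  -- complement: `P(N ≥ j+1) = 1 − P(N ≤ j)`
  have hfilt : (Finset.univ : Finset (Finset ι)).filter (fun W => ∑ k ∈ W, (a k : ℝ) ≤ (j : ℝ)) =
      (Finset.univ : Finset (Finset ι)).filter (fun W => ∑ k ∈ W, a k ≤ j) := by
    ext W
    simp only [Finset.mem_filter, Finset.mem_univ, true_and]
    rw [← Nat.cast_sum, Nat.cast_le]
  rw [hfilt, Finset.sum_filter] at row
  have hsum : ∑ W : Finset ι, (∏ k, if k ∈ W then g k else 1 - g k) * (if j + 1 ≤ ∑ k ∈ W, a k then (1 : ℝ) else 0) =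
      ∑ W : Finset ι, ((∏ k, if k ∈ W then g k else 1 - g k) -
        (if ∑ k ∈ W, a k ≤ j then (∏ k, if k ∈ W then g k else 1 - g k) else 0)) := by
    refine Finset.sum_congr rfl fun W _ => ?_
    by_cases hW : ∑ k ∈ W, a k ≤ j
    · rw [if_pos hW, if_neg (by omega), mul_zero, sub_self]
    · rw [if_neg hW, if_pos (by omega), mul_one, sub_zero]
  rw [hsum, Finset.sum_sub_distrib, sum_bernoulliWeight]
  linarith

/-- **Conjecture DIB\* holds at every floor `x ≤ 1/2`** (lead g15's `IndepBlob.dibStar_of_le_half`: a heavy giant decides, else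
Cantelli with the true mean — for a light blob `g(1 − g) ≤ (1 − x)(2g − κ_x(g))`).  OPEN: `1/2 < x < 1`. [this work] -/
theorem DIBStar.of_le_half {x : ℝ} (hx : x ≤ 1 / 2) : DIBStar x := by
  by_cases hx0 : 0 ≤ x
  · exact DIBWith.of_smallBall_heavySet fun ι _ _ p a H j hp0 hp1 ha hH hL hlight hj =>
      dibStar_of_le_half p a x hx0 hx hp0 hp1 ha H hH hL j hj hlight
  · exact dibWith_of_nonpos x _ (not_le.1 hx0).le

/-- DIB-ψ at every floor `x ≤ 1/2`. [this work] -/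
theorem DIBPsi.of_le_half {x : ℝ} (hx : x ≤ 1 / 2) : DIBPsi x :=
  dibPsi_of_dibStar (by linarith) (DIBStar.of_le_half hx)

end IndepBlob

namespace RootDec

open Finset

variable {κ : Type} [Fintype κ] [DecidableEq κ]

/-- configurations of structure counts bounded by `M` (as in `…QuantRootReduction`) -/
local notation3 "cfg[" M "]" => Fintype.piFinset (fun k : κ => Finset.range ((M : κ → ℕ) k + 1))

/-- the ROOT tail (as in `…QuantRootReduction`) -/
local notation3 "RTAIL[" M ", " μ ", " j "]" =>
  ∑ c ∈ cfg[M], (∏ k, (μ : κ → ℕ → ℝ) k ((c : κ → ℕ) k)) * (if (j : ℕ) + 1 ≤ ∑ k, (c : κ → ℕ) k then (1 : ℝ) else 0)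

/-- the two-point law `{lo, hi; g}` (as in `…QuantRootReduction`) -/
local notation3 "TP[" lo ", " hi ", " g ", " h "]" =>
  (g : ℝ) * (if (h : ℕ) = (hi : ℕ) then (1 : ℝ) else 0) + (1 - (g : ℝ)) * (if (h : ℕ) = (lo : ℕ) then (1 : ℝ) else 0)

/-- product-Bernoulli weight of the set `W` of open blobs (as in `…QuantRootReduction`) -/
local notation3 "wt[" g ", " W "]" => ∏ k, (if k ∈ (W : Finset κ) then (g : κ → ℝ) k else 1 - (g : κ → ℝ) k)

/-- the TERM tail `P(s + Σ_{k open} a k ≥ j+1)` (as in `…QuantRootReduction`) -/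
local notation3 "TERM[" s ", " a ", " g ", " j "]" =>
  ∑ W : Finset κ, wt[g, W] * (if (j : ℕ) + 1 ≤ (s : ℕ) + ∑ k ∈ W, (a : κ → ℕ) k then (1 : ℝ) else 0)

/-- **γ at floors `≤ 1/2`, unconditional.**  Gates in `[0,1]`, `x ≤ 1/2`, and the effective discounted credit exceeds `2(j − s)`:
`2j < 2s + Σ_k [a k·g k if x ≤ g k, else min(a k, j − s)·max((g k − x²)/(1 − x), 0)]` ⟹ `x ≤ TERM[s, a, g, j]`. [this work] -/
theorem term_ge_of_credit_of_le_half (s : ℕ) (a : κ → ℕ) (g : κ → ℝ) (j : ℕ) (x : ℝ) (hx : x ≤ 1 / 2)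
    (hg : ∀ k, 0 ≤ g k ∧ g k ≤ 1)
    (hbudget : (2 * j : ℝ) < 2 * s + ∑ k, (if x ≤ g k then (a k : ℝ) * g k
      else ((min (a k) (j - s) : ℕ) : ℝ) * max (((g k) - x ^ 2) / (1 - x)) 0)) : x ≤ TERM[s, a, g, j] :=
  term_ge_of_dibWith_capped (IndepBlob.DIBStar.of_le_half hx) s a g j (by linarith) hg hbudget

/-- **α′ — heavy total `2(j − s) + 1` plus one blob of arbitrary gate, floor `≥ 1/2`** (lead g15's `IndepBlob.sizeRow_with_extra_blob`).
Gates in `[0,1]`, `1/2 ≤ x ≤ 1`, a blob `x₀` of ANY gate, every other blob heavy (`x ≤ g k`, `k ≠ x₀`), and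
`2(j − s) + 1 + a x₀ ≤ Σ_k a k`: then `x ≤ TERM[s, a, g, j]`; no credit hypothesis. [this work] -/
theorem term_ge_of_extraBlob (s : ℕ) (a : κ → ℕ) (g : κ → ℝ) (j : ℕ) (x : ℝ) (hx : 1 / 2 ≤ x) (hx1 : x ≤ 1)
    (hg : ∀ k, 0 ≤ g k ∧ g k ≤ 1) (x₀ : κ) (hheavy : ∀ k, k ≠ x₀ → x ≤ g k)
    (hsize : 2 * (j - s) + 1 + a x₀ ≤ ∑ k, a k) : x ≤ TERM[s, a, g, j] := by
  by_cases hs : j + 1 ≤ s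
  · rw [term_eq_one_of_sure s a g j hs]; exact hx1
  have hsj : s ≤ j := by omega
  -- a second blob exists: otherwise the sizes total `a x₀`
  have hne : (Finset.univ.erase x₀).Nonempty := by
    by_contra hemp
    rw [Finset.not_nonempty_iff_eq_empty] at hemp
    have huniv : (Finset.univ : Finset κ) = {x₀} := by
      rw [← Finset.insert_erase (Finset.mem_univ x₀), hemp]; rfl
    have : ∑ k, a k = a x₀ := by rw [huniv, Finset.sum_singleton]
    omega
  obtain ⟨y₀, hy₀, hy₀min⟩ := Finset.exists_min_image _ g hne
  have hy₀ne : y₀ ≠ x₀ := Finset.ne_of_mem_erase hy₀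
  have hxy₀ : x ≤ g y₀ := hheavy y₀ hy₀ne
  have row := IndepBlob.sizeRow_with_extra_blob g a (fun k => (hg k).1) (fun k => (hg k).2) x₀ y₀ hy₀ne
    (fun k hk => hy₀min k (Finset.mem_erase.2 ⟨hk, Finset.mem_univ k⟩)) (hx.trans hxy₀) (j - s) hsize
  rw [term_shift s a g j hsj]
  rw [Finset.sum_filter] at row
  refine hxy₀.trans (row.trans (le_of_eq (Finset.sum_congr rfl fun W _ => ?_)))
  split_ifs <;> simp

/-- **R3 at floors `≤ 1/2`, unconditional.**  `Quant.RootDec.rtail_ge_of_decCert` with the DIB hypothesis discharged by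
`DIBStar.of_le_half`: structure laws decomposed into two-point components (genuine gates in `[0,1]`), every genuine term certified
by β / α / γ (with `ψ = κ_x`), `x ≤ 1/2` ⟹ `x ≤ RTAIL[M, μ, j]`. [this work] -/
theorem rtail_ge_of_decCert_of_le_half {ρ : Type*} [Fintype ρ] [DecidableEq ρ] {x : ℝ} (hx : x ≤ 1 / 2)
    (M : κ → ℕ) (μ : κ → ℕ → ℝ) (lam : κ → ρ → ℝ) (lo hi : κ → ρ → ℕ) (g : κ → ρ → ℝ) (j : ℕ)
    (hlam0 : ∀ k r, 0 ≤ lam k r) (hlam1 : ∀ k, ∑ r, lam k r = 1)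
    (hμ : ∀ k h, μ k h = ∑ r, lam k r * TP[lo k r, hi k r, g k r, h])
    (hlohi : ∀ k r, lo k r ≤ hi k r) (hhi : ∀ k r, hi k r ≤ M k)
    (hg : ∀ k r, 0 < lam k r → 0 ≤ g k r ∧ g k r ≤ 1)
    (hcert : ∀ σ : κ → ρ, (∀ k, 0 < lam k (σ k)) →
      (j + 1 ≤ ∑ k, lo k (σ k)) ∨
      (∃ k, x ≤ g k (σ k) ∧ j + 1 ≤ (∑ k', lo k' (σ k')) + (hi k (σ k) - lo k (σ k))) ∨
      ((2 * j : ℝ) < 2 * ((∑ k, lo k (σ k) : ℕ) : ℝ) + ∑ k, (if x ≤ g k (σ k)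
        then ((hi k (σ k) - lo k (σ k) : ℕ) : ℝ) * g k (σ k)
        else ((min (hi k (σ k) - lo k (σ k)) (j - ∑ k', lo k' (σ k')) : ℕ) : ℝ) *
          max ((g k (σ k) - x ^ 2) / (1 - x)) 0))) :
    x ≤ RTAIL[M, μ, j] :=
  rtail_ge_of_decCert (IndepBlob.DIBStar.of_le_half hx) M μ lam lo hi g j (by linarith) hlam0 hlam1 hμ hlohi hhi hg hcert

end RootDec

end Quant

end Summit.CriticalPhenomena.PercolationContinuityZ3.Theorems
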